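import Mathlib.Analysis.Normed.Algebra.MatrixExponential
import Mathlib.Analysis.SpecialFunctions.Exponential
import Mathlib.Analysis.Calculus.Deriv.Mul
import Mathlib.Analysis.Calculus.Deriv.Add
import Mathlib.Analysis.Calculus.Deriv.Comp
import Mathlib.Analysis.Calculus.IteratedDeriv.Defs
import Mathlib.Topology.Algebra.Module.FiniteDimension
import Summits.Ventures.YMGap.Thresholds.SinglePlaquetteSOS

/-!
# Venture YMGap — Theorem C, calculus part: `word2` IS the second derivative of the
# exponentially perturbed word

HONEST FRAMING: venture file (cell `pub-ymgap`, track (a), item A2 = "Theorem C" of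
`p2/HESSIAN-SHARP.md`). `SinglePlaquetteSOS.word2 V₁ B₁ V₂ B₂ V₃ B₃ V₄ B₄` was DEFINED there as an
explicit polynomial and described as "twice the `t²`-Taylor coefficient of
`t ↦ Re tr(e^{tV₁}B₁e^{tV₂}B₂e^{tV₃}B₃e^{tV₄}B₄)`". This file PROVES that description
(target T2.1 of `p2/LEAN-TARGETS-A2.md`, finite-dimensional calculus only):

* `expWord B₀ V₁ B₁ V₂ B₂ V₃ B₃ V₄ B₄ t = B₀ e^{tV₁} B₁ e^{tV₂} B₂ e^{tV₃} B₃ e^{tV₄} B₄`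
  (matrix exponential `NormedSpace.exp`), `reTrWord … t = Re tr(expWord … t)`;
* `hasDerivAt_expWord`: the product rule — the derivative is the sum of the four words in which the
  constant preceding `e^{tV_i}` is multiplied by `V_i`;
* `hasDerivAt_reTrWord`, `hasDerivAt_deriv_reTrWord_zero`, and the packaged statement
  `iteratedDeriv_two_reTrWord : iteratedDeriv 2 (reTrWord 1 V₁ B₁ V₂ B₂ V₃ B₃ V₄ B₄) 0 = word2 V₁ B₁ V₂ B₂ V₃ B₃ V₄ B₄`.

No statement about measures, Bakry–Émery constants or thresholds is made here; the lattice
corollary (second variation of `Σ_p Re tr hol_p` along `e^{tX}Q` is `hessianForm Q X ≤ 4d‖X‖²`)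
is in `WilsonHessian.lean`.

Technique: Mathlib's `hasDerivAt_exp_smul_const'` in the scoped `L^∞`-operator normed algebra
structure on matrices (as in `Literature/Analysis/Matrix/DetExp.lean`), `HasDerivAt.mul`, and the
real part of the trace as a continuous `ℝ`-linear map (finite dimension).
-/

noncomputable section

namespace Summit.Ventures.YMGap.HessianSharp

open Matrix Complex NormedSpace
open scoped Matrix ComplexConjugate BigOperators

variable {n : Type*} [Fintype n] [DecidableEq n]

/-- The exponentially perturbed word `B₀ e^{tV₁} B₁ e^{tV₂} B₂ e^{tV₃} B₃ e^{tV₄} B₄` (matrix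
exponential; five constant matrices `B₀..B₄`, four directions `V₁..V₄`). -/
def expWord (B₀ V₁ B₁ V₂ B₂ V₃ B₃ V₄ B₄ : Matrix n n ℂ) (t : ℝ) : Matrix n n ℂ :=
  B₀ * exp (t • V₁) * B₁ * exp (t • V₂) * B₂ * exp (t • V₃) * B₃ * exp (t • V₄) * B₄

/-- The real-valued function `t ↦ Re tr(B₀ e^{tV₁} B₁ e^{tV₂} B₂ e^{tV₃} B₃ e^{tV₄} B₄)`. -/
def reTrWord (B₀ V₁ B₁ V₂ B₂ V₃ B₃ V₄ B₄ : Matrix n n ℂ) (t : ℝ) : ℝ :=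
  (expWord B₀ V₁ B₁ V₂ B₂ V₃ B₃ V₄ B₄ t).trace.re

/-- At `t = 0` the word is the product of its constants. -/
theorem expWord_zero (B₀ V₁ B₁ V₂ B₂ V₃ B₃ V₄ B₄ : Matrix n n ℂ) :
    expWord B₀ V₁ B₁ V₂ B₂ V₃ B₃ V₄ B₄ 0 = B₀ * B₁ * B₂ * B₃ * B₄ := by
  simp only [expWord, zero_smul, NormedSpace.exp_zero, Matrix.mul_one]

/-- `Re tr(word)` at `t = 0`. -/
theorem reTrWord_zero (B₀ V₁ B₁ V₂ B₂ V₃ B₃ V₄ B₄ : Matrix n n ℂ) :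
    reTrWord B₀ V₁ B₁ V₂ B₂ V₃ B₃ V₄ B₄ 0 = (B₀ * B₁ * B₂ * B₃ * B₄).trace.re := by
  rw [reTrWord, expWord_zero]

section Calculus

-- As in `Literature/Analysis/Matrix/DetExp.lean` / Mathlib's `MatrixExponential.lean`: the analytic
-- facts about `exp` are used in the scoped `L∞`-operator normed algebra structure on matrices,
-- which is only reducibly-defeq to the Pi uniformity.
set_option backward.isDefEq.respectTransparency false

open scoped Matrix.Norms.Operator

/-- **Product rule for the word** (matrix-valued; stated in the scoped `L^∞`-operator norm):
`d/dt (B₀e^{tV₁}B₁e^{tV₂}B₂e^{tV₃}B₃e^{tV₄}B₄)` is the sum of the four words whose constant in front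
of `e^{tV_i}` is multiplied on the right by `V_i` (using `d/dt e^{tV} = V e^{tV}`). -/
theorem hasDerivAt_expWord (B₀ V₁ B₁ V₂ B₂ V₃ B₃ V₄ B₄ : Matrix n n ℂ) (t : ℝ) :
    HasDerivAt (expWord B₀ V₁ B₁ V₂ B₂ V₃ B₃ V₄ B₄)
      (expWord (B₀ * V₁) V₁ B₁ V₂ B₂ V₃ B₃ V₄ B₄ t + expWord B₀ V₁ (B₁ * V₂) V₂ B₂ V₃ B₃ V₄ B₄ t
        + expWord B₀ V₁ B₁ V₂ (B₂ * V₃) V₃ B₃ V₄ B₄ t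
        + expWord B₀ V₁ B₁ V₂ B₂ V₃ (B₃ * V₄) V₄ B₄ t) t := by
  have e₁ := hasDerivAt_exp_smul_const' (𝕂 := ℝ) V₁ t
  have e₂ := hasDerivAt_exp_smul_const' (𝕂 := ℝ) V₂ t
  have e₃ := hasDerivAt_exp_smul_const' (𝕂 := ℝ) V₃ t
  have e₄ := hasDerivAt_exp_smul_const' (𝕂 := ℝ) V₄ t
  have h := (((((((e₁.const_mul B₀).mul_const B₁).fun_mul e₂).mul_const B₂).fun_mul e₃).mul_const
    B₃).fun_mul e₄).mul_const B₄
  refine h.congr_deriv ?_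
  simp only [expWord, Matrix.add_mul, Matrix.mul_assoc]

/-- The real part of the trace as a continuous `ℝ`-linear functional on `n × n` complex matrices
(finite dimension; norm-independent as a function). -/
def reTrCLM : Matrix n n ℂ →L[ℝ] ℝ :=
  LinearMap.toContinuousLinearMap
    { toFun := fun M => M.trace.re
      map_add' := fun A B => by simp [Matrix.trace_add]
      map_smul' := fun r A => by simp [Matrix.trace_smul] }

omit [DecidableEq n] in
/-- Chain rule through `Re tr`: if `W` has derivative `W'` then `t ↦ Re tr W(t)` has derivative
`Re tr W'`. -/
theorem hasDerivAt_reTrace {W : ℝ → Matrix n n ℂ} {W' : Matrix n n ℂ} {t : ℝ}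
    (h : HasDerivAt W W' t) : HasDerivAt (fun s => (W s).trace.re) W'.trace.re t :=
  HasFDerivAt.comp_hasDerivAt t (reTrCLM (n := n)).hasFDerivAt h

/-- **First derivative of `Re tr(word)`** (real-valued, norm-free statement):
`d/dt Re tr(B₀e^{tV₁}…B₄) = Σ_i Re tr(word with B_{i-1} ↦ B_{i-1}V_i)`. -/
theorem hasDerivAt_reTrWord (B₀ V₁ B₁ V₂ B₂ V₃ B₃ V₄ B₄ : Matrix n n ℂ) (t : ℝ) :
    HasDerivAt (reTrWord B₀ V₁ B₁ V₂ B₂ V₃ B₃ V₄ B₄)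
      (reTrWord (B₀ * V₁) V₁ B₁ V₂ B₂ V₃ B₃ V₄ B₄ t + reTrWord B₀ V₁ (B₁ * V₂) V₂ B₂ V₃ B₃ V₄ B₄ t
        + reTrWord B₀ V₁ B₁ V₂ (B₂ * V₃) V₃ B₃ V₄ B₄ t
        + reTrWord B₀ V₁ B₁ V₂ B₂ V₃ (B₃ * V₄) V₄ B₄ t) t := by
  have h := hasDerivAt_reTrace (hasDerivAt_expWord B₀ V₁ B₁ V₂ B₂ V₃ B₃ V₄ B₄ t)
  refine h.congr_deriv ?_
  simp only [reTrWord, Matrix.trace_add, Complex.add_re]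

/-- **Second derivative at `t = 0`**: the derivative at `0` of the first derivative of
`Re tr(e^{tV₁}B₁e^{tV₂}B₂e^{tV₃}B₃e^{tV₄}B₄)` is `word2 V₁ B₁ V₂ B₂ V₃ B₃ V₄ B₄` (the 16 ordered
insertions `(i,k)` collapse to the diagonal terms once and the pairs `i<k` twice). -/
theorem hasDerivAt_deriv_reTrWord_zero (V₁ B₁ V₂ B₂ V₃ B₃ V₄ B₄ : Matrix n n ℂ) :
    HasDerivAt (fun t => reTrWord (1 * V₁) V₁ B₁ V₂ B₂ V₃ B₃ V₄ B₄ t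
        + reTrWord 1 V₁ (B₁ * V₂) V₂ B₂ V₃ B₃ V₄ B₄ t
        + reTrWord 1 V₁ B₁ V₂ (B₂ * V₃) V₃ B₃ V₄ B₄ t
        + reTrWord 1 V₁ B₁ V₂ B₂ V₃ (B₃ * V₄) V₄ B₄ t)
      (word2 V₁ B₁ V₂ B₂ V₃ B₃ V₄ B₄) 0 := by
  have h := (((hasDerivAt_reTrWord (1 * V₁) V₁ B₁ V₂ B₂ V₃ B₃ V₄ B₄ 0).add
    (hasDerivAt_reTrWord 1 V₁ (B₁ * V₂) V₂ B₂ V₃ B₃ V₄ B₄ 0)).add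
    (hasDerivAt_reTrWord 1 V₁ B₁ V₂ (B₂ * V₃) V₃ B₃ V₄ B₄ 0)).add
    (hasDerivAt_reTrWord 1 V₁ B₁ V₂ B₂ V₃ (B₃ * V₄) V₄ B₄ 0)
  refine h.congr_deriv ?_
  simp only [reTrWord_zero, ← Complex.add_re]
  unfold word2
  congr 1
  simp only [Matrix.one_mul, Matrix.mul_assoc]
  ring

end Calculus

/-- **T2.1 (calculus identification of `word2`)**: the second derivative at `t = 0` of
`t ↦ Re tr(e^{tV₁}B₁e^{tV₂}B₂e^{tV₃}B₃e^{tV₄}B₄)` is `word2 V₁ B₁ V₂ B₂ V₃ B₃ V₄ B₄`. -/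
theorem iteratedDeriv_two_reTrWord (V₁ B₁ V₂ B₂ V₃ B₃ V₄ B₄ : Matrix n n ℂ) :
    iteratedDeriv 2 (reTrWord 1 V₁ B₁ V₂ B₂ V₃ B₃ V₄ B₄) 0 = word2 V₁ B₁ V₂ B₂ V₃ B₃ V₄ B₄ := by
  rw [iteratedDeriv_succ, iteratedDeriv_one]
  have h1 : deriv (reTrWord 1 V₁ B₁ V₂ B₂ V₃ B₃ V₄ B₄) = fun t =>
      reTrWord (1 * V₁) V₁ B₁ V₂ B₂ V₃ B₃ V₄ B₄ t + reTrWord 1 V₁ (B₁ * V₂) V₂ B₂ V₃ B₃ V₄ B₄ t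
        + reTrWord 1 V₁ B₁ V₂ (B₂ * V₃) V₃ B₃ V₄ B₄ t
        + reTrWord 1 V₁ B₁ V₂ B₂ V₃ (B₃ * V₄) V₄ B₄ t := by
    funext t
    exact (hasDerivAt_reTrWord 1 V₁ B₁ V₂ B₂ V₃ B₃ V₄ B₄ t).deriv
  rw [h1]
  exact (hasDerivAt_deriv_reTrWord_zero V₁ B₁ V₂ B₂ V₃ B₃ V₄ B₄).deriv

/-- The first derivative at `t = 0` of `Re tr(e^{tV₁}B₁…e^{tV₄}B₄)` is
`Σ_i Re tr(B₁…B_{i-1} V_i B_i … B₄)` — recorded for completeness (the first variation of the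
Wilson plaquette term). -/
theorem deriv_reTrWord_zero (V₁ B₁ V₂ B₂ V₃ B₃ V₄ B₄ : Matrix n n ℂ) :
    deriv (reTrWord 1 V₁ B₁ V₂ B₂ V₃ B₃ V₄ B₄) 0 =
      (V₁ * B₁ * B₂ * B₃ * B₄).trace.re + (B₁ * V₂ * B₂ * B₃ * B₄).trace.re
        + (B₁ * B₂ * V₃ * B₃ * B₄).trace.re + (B₁ * B₂ * B₃ * V₄ * B₄).trace.re := by
  rw [(hasDerivAt_reTrWord 1 V₁ B₁ V₂ B₂ V₃ B₃ V₄ B₄ 0).deriv]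
  simp only [reTrWord_zero, Matrix.one_mul, Matrix.mul_assoc]

end Summit.Ventures.YMGap.HessianSharp
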